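import Summits.KontsevichZagierPeriods.KontsevichZagierPeriods.Theorems.SoloInformedAlgStrip
import Summits.KontsevichZagierPeriods.KontsevichZagierPeriods.Theorems.SoloInformedAlgIsolate
import Summits.KontsevichZagierPeriods.KontsevichZagierPeriods.Theorems.SoloInformedAlgDiagRule
import HarnessLib

/-!
# The DEN-calculus over `K`: the vertex-germ property and its local packages

Solo programme `solo-KontsevichZagierPeriods-informed`, session s107, step (x-g) of the general
two-dimensional algorithm.  The induction of the algorithm runs over **vertex germs**: the
property `SoloInformedVertexGermOK F` says that `xᵉ · u · U · F` is a presentable denominator for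
every monomial `xᵉ u` and every unit `U` (no zero on the closed square), provided `F` has no zero on
the closed square except possibly the vertex `0`.

* `soloInformed_locallyPresentableDenK_congr` — local presentability only depends on the values
  on the open square;
* `soloInformedBlowLowK F m = F(v₀, v₀v₁)/v₀^m` (the lower blow-up chart) and the **child germs**
  `soloInformedChildK F m t κ λ = F_low(κ x₀, t + λ x₁)`, with their evaluation lemmas;
* **vertex packages** `soloInformed_locallyPresentableDenK_vertex_of_germOK` (vertex `0`) and
  `soloInformed_locallyPresentableDenK_vertex01_of_germOK` (vertex `(0,1)`, by reflection): local
  presentability of `xᵉ u · W · B` at the vertex follows from the vertex-germ property of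
  polynomials taking the values of the rescaled corner germs `B(x/N)`.

References: M. Kontsevich, D. Zagier, *Periods* (2001), §1.2; J. Kollár, *Lectures on Resolution
of Singularities* (2007), §1.8–1.10.
-/

noncomputable section

open scoped BigOperators
open MeasureTheory Set
open Literature.NumberTheory.Transcendental Literature.NumberTheory.Transcendental.KZ

namespace Summit.KontsevichZagierPeriods.KontsevichZagierPeriods.Theorems

variable {n : ℕ} {K : Type*} [Field K] [Algebra K ℝ]

/-! ### Local presentability depends only on the open cube -/

/-- Local presentability is invariant under change of the polynomial away from the open cube.
[this work] -/
theorem soloInformed_locallyPresentableDenK_congr {Q Q' : MvPolynomial (Fin n) K}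
    (hQQ' : ∀ x ∈ soloInformedOpenCube n,
      (MvPolynomial.aeval x Q : ℝ) = MvPolynomial.aeval x Q')
    {p : Fin n → ℝ} (h : SoloInformedLocallyPresentableDenK Q p) :
    SoloInformedLocallyPresentableDenK Q' p := by
  obtain ⟨ε, hε, hH⟩ := h
  exact ⟨ε, hε, fun N c hN hc hcell => soloInformed_presentableDenK_congr (fun x hx => by
    rw [soloInformed_aeval_gridSubstK, soloInformed_aeval_gridSubstK,
      hQQ' _ (soloInformed_gridMoveR_mem_openCube _ hc hx)]) (hH N c hN hc hcell)⟩

/-- The grid move of the cell at the origin maps the closed cube into itself. [this work] -/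
theorem soloInformed_gridMoveR_zero_mem_cube {N : ℕ} (hN : 0 < N) {y : Fin n → ℝ}
    (hy : y ∈ soloInformedCube n) :
    soloInformedGridMoveR Finset.univ N (fun _ => 0) y ∈ soloInformedCube n := by
  rw [soloInformed_gridMoveR_univ]
  have hN' : (0 : ℝ) < N := by exact_mod_cast hN
  have hN1 : (1 : ℝ) ≤ N := by exact_mod_cast hN
  intro j
  simp only [Nat.cast_zero, zero_add]
  exact ⟨div_nonneg (hy j).1 hN'.le, (div_le_one hN').2 ((hy j).2.trans hN1)⟩

/-- Evaluation of a monomial at a real point. [this work] -/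
theorem soloInformed_aevalK_monomial (e : Fin n →₀ ℕ) (u : K) (x : Fin n → ℝ) :
    (MvPolynomial.aeval x (MvPolynomial.monomial e u) : ℝ) = algebraMap K ℝ u * ∏ j, x j ^ e j := by
  rw [MvPolynomial.aeval_monomial, Finsupp.prod_fintype _ _ fun i => pow_zero _]

/-! ### The vertex-germ property -/

/-- **The vertex-germ property** of `F ∈ K[x₀, x₁]`: if `F` has no zero on the closed square
other than (possibly) the vertex `0`, then `xᵉ u · U · F` is a presentable denominator for every
monomial `xᵉ u` (`u ≠ 0`) and every `U` without zero on the closed square. [this work] -/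
def SoloInformedVertexGermOK (F : MvPolynomial (Fin 2) K) : Prop :=
  ∀ (e : Fin 2 →₀ ℕ) (u : K) (U : MvPolynomial (Fin 2) K), u ≠ 0 →
    (∀ y ∈ soloInformedCube 2, (MvPolynomial.aeval y U : ℝ) ≠ 0) →
    (∀ y ∈ soloInformedCube 2, y ≠ 0 → (MvPolynomial.aeval y F : ℝ) ≠ 0) →
    SoloInformedPresentableDenK (MvPolynomial.monomial e u * (U * F))

/-- A polynomial without zero on the closed square has the vertex-germ property (RULE LEAF).
[this work] -/
theorem soloInformed_vertexGermOK_of_forall_ne_zero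
    (hK : ∀ c : K, IsAlgebraic ℚ (algebraMap K ℝ c)) {F : MvPolynomial (Fin 2) K}
    (hF : ∀ y ∈ soloInformedCube 2, (MvPolynomial.aeval y F : ℝ) ≠ 0) :
    SoloInformedVertexGermOK F := fun e _ _ hu hU _ =>
  soloInformed_presentableDenK_monomial_mul_of_forall_ne_zero hK e hu fun y hy => by
    rw [map_mul]; exact mul_ne_zero (hU y hy) (hF y hy)

/-! ### The lower blow-up chart and the child germs -/

/-- The lower blow-up chart quotient `F_low(v) = F(v₀, v₀v₁) / v₀^m`. [this work] -/
def soloInformedBlowLowK (F : MvPolynomial (Fin 2) K) (m : ℕ) : MvPolynomial (Fin 2) K :=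
  soloInformedChartQuotK soloInformedLowerMat F ![m, 0]

/-- `F(v₀, v₀v₁) = v₀^m · F_low(v)` when every monomial of `F` has total degree `≥ m`.
[this work] -/
theorem soloInformed_aeval_lowerChart_eq_pow_mul_blowLowK (F : MvPolynomial (Fin 2) K) {m : ℕ}
    (hm : ∀ a ∈ F.support, m ≤ a 0 + a 1) (v : Fin 2 → ℝ) :
    (MvPolynomial.aeval ![v 0, v 0 * v 1] F : ℝ) =
      v 0 ^ m * MvPolynomial.aeval v (soloInformedBlowLowK F m) := by
  have h := soloInformed_aevalK_monomialMap_eq soloInformedLowerMat F ![m, 0] (fun a ha j => by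
    fin_cases j
    · simpa [soloInformedLowerMat, Fin.sum_univ_two] using hm a ha
    · simp) v
  rw [soloInformed_lowerChart_eq] at h
  rw [h, soloInformedBlowLowK, Fin.prod_univ_two]
  simp

/-- `F_low` has no zero at the points of the closed square off the exceptional edge `v₀ = 0`, if
`F` vanishes only at `0`. [this work] -/
theorem soloInformed_aeval_blowLowK_ne_zero (F : MvPolynomial (Fin 2) K) {m : ℕ}
    (hm : ∀ a ∈ F.support, m ≤ a 0 + a 1)
    (hF : ∀ y ∈ soloInformedCube 2, y ≠ 0 → (MvPolynomial.aeval y F : ℝ) ≠ 0)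
    {v : Fin 2 → ℝ} (hv : v ∈ soloInformedCube 2) (hv0 : 0 < v 0) :
    (MvPolynomial.aeval v (soloInformedBlowLowK F m) : ℝ) ≠ 0 := by
  intro h0
  have hy : (![v 0, v 0 * v 1] : Fin 2 → ℝ) ∈ soloInformedCube 2 := by
    intro j
    fin_cases j
    · exact ⟨hv0.le, (hv 0).2⟩
    · exact ⟨mul_nonneg hv0.le (hv 1).1, by
        simpa using mul_le_mul (hv 0).2 (hv 1).2 (hv 1).1 zero_le_one⟩
  have hy0 : (![v 0, v 0 * v 1] : Fin 2 → ℝ) ≠ 0 := fun h => by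
    have := congr_fun h 0
    simp at this
    exact hv0.ne' this
  exact hF _ hy hy0 (by rw [soloInformed_aeval_lowerChart_eq_pow_mul_blowLowK F hm, h0, mul_zero])

/-- **The child germs** `F_low(κ x₀, t + λ x₁)` of `F` at the point `(0, t)` of the exceptional
edge, read at the scales `κ, λ`. [this work] -/
def soloInformedChildK (F : MvPolynomial (Fin 2) K) (m : ℕ) (t κ lam : K) :
    MvPolynomial (Fin 2) K :=
  soloInformedScaleSubstK 0 0 κ (soloInformedScaleSubstK 1 t lam (soloInformedBlowLowK F m))

/-- Values of the child germs. [this work] -/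
theorem soloInformed_aeval_childK (F : MvPolynomial (Fin 2) K) (m : ℕ) (t κ lam : K)
    (x : Fin 2 → ℝ) :
    (MvPolynomial.aeval x (soloInformedChildK F m t κ lam) : ℝ) =
      MvPolynomial.aeval ![algebraMap K ℝ κ * x 0, algebraMap K ℝ t + algebraMap K ℝ lam * x 1]
        (soloInformedBlowLowK F m) := by
  unfold soloInformedChildK
  rw [soloInformed_aeval_scaleSubstK, soloInformed_aeval_scaleSubstK, map_zero]
  have hpt : soloInformedScaleMoveR 1 (algebraMap K ℝ t) (algebraMap K ℝ lam)
      (soloInformedScaleMoveR 0 0 (algebraMap K ℝ κ) x) =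
      ![algebraMap K ℝ κ * x 0, algebraMap K ℝ t + algebraMap K ℝ lam * x 1] := by
    funext j
    fin_cases j <;> simp [soloInformedScaleMoveR]
  rw [hpt]

/-! ### Vertex packages -/

/-- **Vertex package at `0`.**  Let `Q = xᵉ u · W · B` with `W` a unit on the closed square and `B`
without zero `y ≠ 0` in the closed square with coordinates `< 1`.  If for every `N ≥ 2` some
polynomial `Ch` with the vertex-germ property and an isolated zero takes the values `B(x/N)` on
the open square, then `Q` is locally presentable at `0`. [this work] -/
theorem soloInformed_locallyPresentableDenK_vertex_of_germOK
    (hK : ∀ c : K, IsAlgebraic ℚ (algebraMap K ℝ c)) (e : Fin 2 →₀ ℕ) {u : K} (hu : u ≠ 0)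
    {W B : MvPolynomial (Fin 2) K}
    (hW : ∀ y ∈ soloInformedCube 2, (MvPolynomial.aeval y W : ℝ) ≠ 0)
    (hB : ∀ y ∈ soloInformedCube 2, (∀ j, y j < 1) → y ≠ 0 → (MvPolynomial.aeval y B : ℝ) ≠ 0)
    (hgerms : ∀ N : ℕ, 1 < N → ∃ Ch : MvPolynomial (Fin 2) K, SoloInformedVertexGermOK Ch ∧
      (∀ y ∈ soloInformedCube 2, y ≠ 0 → (MvPolynomial.aeval y Ch : ℝ) ≠ 0) ∧
      ∀ x ∈ soloInformedOpenCube 2,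
        (MvPolynomial.aeval x Ch : ℝ) = MvPolynomial.aeval (fun j => x j / N) B) :
    SoloInformedLocallyPresentableDenK (MvPolynomial.monomial e u * (W * B)) 0 := by
  refine soloInformed_locallyPresentableDenK_zero_of_germs hK e hu (G := W * B) one_pos
    (fun y hy hlt hy0 => by rw [map_mul]; exact mul_ne_zero (hW y hy) (hB y hy hlt hy0)) 1
    fun N hN => ?_
  have hN0 : 0 < N := lt_trans zero_lt_one hN
  have hNr : (0 : ℝ) < N := by exact_mod_cast hN0
  obtain ⟨Ch, hCh, hChiso, hChval⟩ := hgerms N hN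
  -- the rescaled unit `W_N(x) = W(x/N)`
  have hWN : ∀ y ∈ soloInformedCube 2, (MvPolynomial.aeval y
      (soloInformedGridSubstK Finset.univ N (fun _ => 0) W) : ℝ) ≠ 0 := fun y hy => by
    rw [soloInformed_aeval_gridSubstK]
    exact hW _ (soloInformed_gridMoveR_zero_mem_cube hN0 hy)
  have hP := soloInformed_presentableDenK_C_mul (∏ j, ((N : K)⁻¹) ^ e j) (hCh e u _ hu hWN hChiso)
  refine soloInformed_presentableDenK_congr (fun x hx => ?_) hP
  have hgrid : (fun j => (((fun _ => (0 : ℕ)) j : ℝ) + x j) / (N : ℝ)) = fun j => x j / N := by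
    funext j; rw [Nat.cast_zero, zero_add]
  rw [map_mul, MvPolynomial.aeval_C, soloInformed_aeval_gridSubstK, soloInformed_gridMoveR_univ,
    hgrid, map_mul, map_mul, map_mul, map_mul, soloInformed_aevalK_monomial,
    soloInformed_aevalK_monomial, soloInformed_aeval_gridSubstK, soloInformed_gridMoveR_univ, hgrid,
    hChval x hx, map_prod]
  simp only [map_pow, map_inv₀, map_natCast]
  have hprod : (∏ j, (x j / (N : ℝ)) ^ e j) = (∏ j, ((N : ℝ)⁻¹) ^ e j) * ∏ j, x j ^ e j := by
    rw [← Finset.prod_mul_distrib]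
    exact Finset.prod_congr rfl fun j _ => by rw [div_eq_mul_inv, mul_pow, mul_comm]
  rw [hprod]
  ring

/-- The vertex `(0,1)` is the reflection of `0` in the second coordinate. [this work] -/
theorem soloInformed_vertexMove_one_zero :
    soloInformedVertexMove ({1} : Finset (Fin 2)) (0 : Fin 2 → ℝ) = ![0, 1] := by
  funext j
  fin_cases j <;> simp [soloInformedVertexMove]

/-- **Vertex package at `(0,1)`.**  Let `Q = x₀^{e₀} u · W · B` with `W` a unit on the closed
square, `B ≠ 0` on the open square, and `B ∘ ρ` (`ρ` the reflection `x₁ ↦ 1 − x₁`) without zero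
`y ≠ 0` in the closed square with coordinates `< 1`.  If for every `N ≥ 2` some polynomial with
the vertex-germ property and an isolated zero takes the values `B(ρ(x/N))` on the open square,
then `Q` is locally presentable at `(0,1)`. [this work] -/
theorem soloInformed_locallyPresentableDenK_vertex01_of_germOK
    (hK : ∀ c : K, IsAlgebraic ℚ (algebraMap K ℝ c)) (e₀ : ℕ) {u : K} (hu : u ≠ 0)
    {W B : MvPolynomial (Fin 2) K}
    (hW : ∀ y ∈ soloInformedCube 2, (MvPolynomial.aeval y W : ℝ) ≠ 0)
    (hB0 : ∀ x ∈ soloInformedOpenCube 2, (MvPolynomial.aeval x B : ℝ) ≠ 0)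
    (hB : ∀ y ∈ soloInformedCube 2, (∀ j, y j < 1) → y ≠ 0 →
      (MvPolynomial.aeval (soloInformedVertexMove ({1} : Finset (Fin 2)) y) B : ℝ) ≠ 0)
    (hgerms : ∀ N : ℕ, 1 < N → ∃ Ch : MvPolynomial (Fin 2) K, SoloInformedVertexGermOK Ch ∧
      (∀ y ∈ soloInformedCube 2, y ≠ 0 → (MvPolynomial.aeval y Ch : ℝ) ≠ 0) ∧
      ∀ x ∈ soloInformedOpenCube 2, (MvPolynomial.aeval x Ch : ℝ) =
        MvPolynomial.aeval (soloInformedVertexMove ({1} : Finset (Fin 2)) (fun j => x j / N)) B) :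
    SoloInformedLocallyPresentableDenK
      (MvPolynomial.monomial (Finsupp.single 0 e₀) u * (W * B)) ![0, 1] := by
  set S : Finset (Fin 2) := {1} with hS
  have hQ : ∀ x ∈ soloInformedOpenCube 2, (MvPolynomial.aeval x
      (MvPolynomial.monomial (Finsupp.single 0 e₀) u * (W * B)) : ℝ) ≠ 0 := fun x hx => by
    rw [map_mul, map_mul, soloInformed_aevalK_monomial]
    refine mul_ne_zero (mul_ne_zero ((map_ne_zero _).2 hu)
      (Finset.prod_ne_zero_iff.2 fun j _ => pow_ne_zero _ (hx j).1.ne')) (mul_ne_zero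
      (hW x (soloInformedOpenCube_subset_cube 2 hx)) (hB0 x hx))
  rw [← soloInformed_vertexMove_one_zero]
  refine soloInformed_locallyPresentableDenK_of_vertexReflect hK S hQ ?_
  rw [soloInformed_vertexMove_vertexMove]
  -- the reflected data
  have hW' : ∀ y ∈ soloInformedCube 2,
      (MvPolynomial.aeval y (soloInformedVertexReflectK S W) : ℝ) ≠ 0 := fun y hy => by
    rw [soloInformed_aeval_vertexReflectK]
    exact hW _ (soloInformed_vertexMove_mem_closedCube S hy)
  have hB' : ∀ y ∈ soloInformedCube 2, (∀ j, y j < 1) → y ≠ 0 →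
      (MvPolynomial.aeval y (soloInformedVertexReflectK S B) : ℝ) ≠ 0 := fun y hy hlt hy0 => by
    rw [soloInformed_aeval_vertexReflectK]
    exact hB y hy hlt hy0
  have hgerms' : ∀ N : ℕ, 1 < N → ∃ Ch : MvPolynomial (Fin 2) K, SoloInformedVertexGermOK Ch ∧
      (∀ y ∈ soloInformedCube 2, y ≠ 0 → (MvPolynomial.aeval y Ch : ℝ) ≠ 0) ∧
      ∀ x ∈ soloInformedOpenCube 2, (MvPolynomial.aeval x Ch : ℝ) =
        MvPolynomial.aeval (fun j => x j / N) (soloInformedVertexReflectK S B) := fun N hN => by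
    obtain ⟨Ch, h1, h2, h3⟩ := hgerms N hN
    exact ⟨Ch, h1, h2, fun x hx => by rw [h3 x hx, soloInformed_aeval_vertexReflectK]⟩
  refine soloInformed_locallyPresentableDenK_congr (fun x hx => ?_)
    (soloInformed_locallyPresentableDenK_vertex_of_germOK hK (Finsupp.single 0 e₀) hu hW' hB'
      hgerms')
  rw [soloInformed_aeval_vertexReflectK, map_mul, map_mul, map_mul, map_mul,
    soloInformed_aevalK_monomial, soloInformed_aevalK_monomial, soloInformed_aeval_vertexReflectK,
    soloInformed_aeval_vertexReflectK]
  congr 2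
  refine Finset.prod_congr rfl fun j _ => ?_
  fin_cases j
  · simp [soloInformedVertexMove, hS]
  · simp

end Summit.KontsevichZagierPeriods.KontsevichZagierPeriods.Theorems
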